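import Summits.HubbardSuperconductivity.HubbardSuperconductivity.Theorems.NodalDiracTwistNodalDiracWeakCouplingMoebiusLemmas
import Summits.HubbardSuperconductivity.HubbardSuperconductivity.Theorems.NodalDiracTwistNodalDiracWeakCouplingMoebiusSections
import Summits.HubbardSuperconductivity.HubbardSuperconductivity.Theorems.NodalDiracTwistNodalDiracWeakCouplingMoebiusPencil
import Summits.HubbardSuperconductivity.HubbardSuperconductivity.Theorems.NodalDiracTwistNodalDiracWeakCouplingMoebiusFrame
import Summits.HubbardSuperconductivity.HubbardSuperconductivity.Theorems.NodalDiracTwistNodalDiracWeakCouplingConeFrame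
import Summits.HubbardSuperconductivity.HubbardSuperconductivity.Theorems.NodalDiracTwistNodalDiracWeakCouplingEllipseSqrt

/-!
# Route `NodalDiracTwist` — crux `NodalDiracWeakCoupling`, line `birth`: the abstract Möbius sign

Helper file (`--supports stmt-HubbardSuperconductivity-10370`): the abstract Longuet-Higgins
theorem `moebiusAbstract_of`, i.e. the registered assembly stub `stub_moebiusAbstract` MODULO the
energy-estimate stub `stub_coneEnergy` (taken here as the explicit hypothesis `hM2`, verbatim its
registered statement); the frame stub `stub_coneFrame` and the square-root stub `stub_ellipseSqrt`
are already landed and used by name.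

Setting: sector `K ≤ (ι → ℂ)`, Hermitian family `H φ` preserving `K` with the variational bound and
existence of sector ground states, antiunitary involution `T` preserving `K` and commuting with
every `H φ`, first-order data `V` at `p` (Taylor bound + form bound), an exactly two-fold sector
ground space at `p`, and the CONE (slope `m > 0` on a punctured disk). Conclusion: on every circle
of radius `r ≤ r₀` about `p`, all fine-mesh cyclic overlap products of unit sector ground states
have negative real part. Proof: `T`-real frame `e₁, e₂` and gap (M1); the real linear pencil
`(a(u), β(u))` (reality by `im_pencil_entry_eq_zero`) is nondegenerate by M2 (i), hence
(`det_ne_zero_of_pencil_nondeg`, `stub_ellipseSqrt`) has an antiperiodic continuous unit square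
root `E`; by M2 (ii) and `pencil_lower_bound` each `T`-real unit ground state on the circle has
overlap `t` with the ideal vector `Re E · e₁ + Im E · e₂`, `t² ≥ 63/64`; ground states are unique
(cone), `T`-real sections exist, links are real, `link_sign` fixes the sign of each link
(`mesh_of_unit_continuous`; the wrap-around link picks up `E(2π) = -E(0)`), and
`prod_neg_of_link_signs` gives the negative product; phases cancel
(`prod_star_smul_dotProduct_smul`). Longuet-Higgins, Proc. R. Soc. A 344 (1975) 147;
Hatsugai, J. Phys. Soc. Jpn. 75 (2006) 123601. No definitions.
-/

-- the mandated namespace `Summit.<Summit>.<Problem>.Theorems` repeats `HubbardSuperconductivity`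
-- (single-problem summit, D-0017), which the `dupNamespace` linter flags on every declaration
set_option linter.dupNamespace false

namespace Summit.HubbardSuperconductivity.HubbardSuperconductivity.Theorems.NodalDiracTwist

open Matrix Complex
open scoped ComplexOrder ComplexConjugate

/-- The mesh angles `2πi/n` (`i < n`) lie in `[0, 7]` (since `2π < 7`), the interval of the
mesh lemma `mesh_of_unit_continuous`. [folklore] -/
theorem mesh_angle_mem_Icc {n : ℕ} (i : Fin n) :
    2 * Real.pi * (i : ℕ) / n ∈ Set.Icc (0 : ℝ) 7 := by
  have hpi := Real.pi_pos
  have hn0 : (0 : ℝ) < n := by exact_mod_cast (lt_of_le_of_lt (Nat.zero_le _) i.isLt)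
  have hi : ((i : ℕ) : ℝ) ≤ n - 1 := by
    have h : (i : ℕ) + 1 ≤ n := i.isLt
    have h' : ((i : ℕ) : ℝ) + 1 ≤ n := by exact_mod_cast h
    linarith
  refine ⟨by positivity, ?_⟩
  rw [div_le_iff₀ hn0]
  nlinarith [Real.pi_lt_d2, hi]

/-- **The abstract Möbius sign (Longuet-Higgins), modulo the energy estimates.** Given the
statement of `stub_coneEnergy` (hypothesis `hM2`, verbatim), the registered statement of
`stub_moebiusAbstract` holds: a conically split, exactly two-fold sector ground state at `p`
forces negative fine-mesh cyclic overlap products of unit sector ground states on every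
sufficiently small circle about `p`. See the module docstring for the proof.
Longuet-Higgins (1975); Hatsugai (2006). [folklore] -/
theorem moebiusAbstract_of
    (hM2 : ∀ {ι : Type} [Fintype ι] [DecidableEq ι]
      (K : Submodule ℂ (ι → ℂ)) (H : (Fin 2 → ℝ) → Matrix ι ι ℂ) (p : Fin 2 → ℝ),
      (H p).IsHermitian →
      (∀ φ, ∀ v ∈ K, star v ⬝ᵥ v = 1 → (H φ).minEnergyOn K ≤ (star v ⬝ᵥ H φ *ᵥ v).re) →
      (∀ φ, ∃ v ∈ K, v ≠ 0 ∧ H φ *ᵥ v = (((H φ).minEnergyOn K : ℝ) : ℂ) • v) →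
      ∀ (V : Fin 2 → Matrix ι ι ℂ) (C : ℝ),
      (∀ (μ : Fin 2) (x w : ι → ℂ), star x ⬝ᵥ x = 1 → star w ⬝ᵥ w = 1 →
        ‖star x ⬝ᵥ (V μ *ᵥ w)‖ ≤ C) →
      (∀ ε : ℝ, 0 < ε → ∃ δ : ℝ, 0 < δ ∧ ∀ y : Fin 2 → ℝ,
        Real.sqrt (y 0 ^ 2 + y 1 ^ 2) ≤ δ → ∀ x w : ι → ℂ, star x ⬝ᵥ x = 1 → star w ⬝ᵥ w = 1 →
          ‖star x ⬝ᵥ ((H (fun ν => p ν + y ν) - H p -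
              (((y 0 : ℝ) : ℂ) • V 0 + ((y 1 : ℝ) : ℂ) • V 1)) *ᵥ w)‖ ≤
            ε * Real.sqrt (y 0 ^ 2 + y 1 ^ 2)) →
      ∀ (e₁ e₂ : ι → ℂ), e₁ ∈ K → e₂ ∈ K → star e₁ ⬝ᵥ e₁ = 1 →
      star e₂ ⬝ᵥ e₂ = 1 → star e₁ ⬝ᵥ e₂ = 0 →
      H p *ᵥ e₁ = (((H p).minEnergyOn K : ℝ) : ℂ) • e₁ →
      H p *ᵥ e₂ = (((H p).minEnergyOn K : ℝ) : ℂ) • e₂ →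
      ∀ (g : ℝ), 0 < g →
      (∀ χ ∈ K, star e₁ ⬝ᵥ χ = 0 → star e₂ ⬝ᵥ χ = 0 → star χ ⬝ᵥ χ = 1 →
        (H p).minEnergyOn K + g ≤ (star χ ⬝ᵥ H p *ᵥ χ).re) →
      (∀ (m ρc : ℝ), 0 < m → 0 < ρc →
        (∀ φ : Fin 2 → ℝ, 0 < (φ 0 - p 0) ^ 2 + (φ 1 - p 1) ^ 2 →
          (φ 0 - p 0) ^ 2 + (φ 1 - p 1) ^ 2 ≤ ρc ^ 2 → ∀ ψ χ : ι → ℂ,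
            (ψ ∈ K ∧ ψ ≠ 0 ∧ H φ *ᵥ ψ = (((H φ).minEnergyOn K : ℝ) : ℂ) • ψ) →
            χ ∈ K → star ψ ⬝ᵥ χ = 0 → star χ ⬝ᵥ χ = 1 →
              (H φ).minEnergyOn K + m * Real.sqrt ((φ 0 - p 0) ^ 2 + (φ 1 - p 1) ^ 2) ≤
                (star χ ⬝ᵥ (H φ *ᵥ χ)).re) →
        ∀ u : Fin 2 → ℝ, u 0 ^ 2 + u 1 ^ 2 = 1 → ∀ (a : ℝ) (b : ℂ),
          a = ((star e₁ ⬝ᵥ ((((u 0 : ℝ) : ℂ) • V 0 + ((u 1 : ℝ) : ℂ) • V 1) *ᵥ e₁)).re -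
                (star e₂ ⬝ᵥ ((((u 0 : ℝ) : ℂ) • V 0 + ((u 1 : ℝ) : ℂ) • V 1) *ᵥ e₂)).re) / 2 →
          b = (star e₁ ⬝ᵥ ((((u 0 : ℝ) : ℂ) • V 0 + ((u 1 : ℝ) : ℂ) • V 1) *ᵥ e₂) +
                star (star e₂ ⬝ᵥ ((((u 0 : ℝ) : ℂ) • V 0 + ((u 1 : ℝ) : ℂ) • V 1) *ᵥ e₁))) / 2 →
          (m / 2) ^ 2 ≤ a ^ 2 + ‖b‖ ^ 2) ∧
      (∀ η : ℝ, 0 < η → ∃ r₁ : ℝ, 0 < r₁ ∧ ∀ r : ℝ, 0 < r → r ≤ r₁ →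
        ∀ u : Fin 2 → ℝ, u 0 ^ 2 + u 1 ^ 2 = 1 → ∀ (a : ℝ) (b : ℂ),
          a = ((star e₁ ⬝ᵥ ((((u 0 : ℝ) : ℂ) • V 0 + ((u 1 : ℝ) : ℂ) • V 1) *ᵥ e₁)).re -
                (star e₂ ⬝ᵥ ((((u 0 : ℝ) : ℂ) • V 0 + ((u 1 : ℝ) : ℂ) • V 1) *ᵥ e₂)).re) / 2 →
          b = (star e₁ ⬝ᵥ ((((u 0 : ℝ) : ℂ) • V 0 + ((u 1 : ℝ) : ℂ) • V 1) *ᵥ e₂) +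
                star (star e₂ ⬝ᵥ ((((u 0 : ℝ) : ℂ) • V 0 + ((u 1 : ℝ) : ℂ) • V 1) *ᵥ e₁))) / 2 →
          ∀ ψ : ι → ℂ,
            (ψ ∈ K ∧ ψ ≠ 0 ∧ H (fun ν => p ν + r * u ν) *ᵥ ψ =
              (((H (fun ν => p ν + r * u ν)).minEnergyOn K : ℝ) : ℂ) • ψ) →
            star ψ ⬝ᵥ ψ = 1 →
              1 - ‖star e₁ ⬝ᵥ ψ‖ ^ 2 - ‖star e₂ ⬝ᵥ ψ‖ ^ 2 ≤ η ∧
              Real.sqrt (a ^ 2 + ‖b‖ ^ 2) * (‖star e₁ ⬝ᵥ ψ‖ ^ 2 + ‖star e₂ ⬝ᵥ ψ‖ ^ 2) +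
                  a * (‖star e₁ ⬝ᵥ ψ‖ ^ 2 - ‖star e₂ ⬝ᵥ ψ‖ ^ 2) +
                  2 * (starRingEnd ℂ (star e₁ ⬝ᵥ ψ) * (star e₂ ⬝ᵥ ψ) * b).re ≤ η)) :
    ∀ (ι : Type) [Fintype ι] [DecidableEq ι] (K : Submodule ℂ (ι → ℂ))
      (H : (Fin 2 → ℝ) → Matrix ι ι ℂ),
      (∀ φ, (H φ).IsHermitian) → (∀ φ, ∀ v ∈ K, H φ *ᵥ v ∈ K) →
      (∀ φ, ∀ v ∈ K, star v ⬝ᵥ v = 1 → (H φ).minEnergyOn K ≤ (star v ⬝ᵥ H φ *ᵥ v).re) →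
      (∀ φ, ∃ v ∈ K, v ≠ 0 ∧ H φ *ᵥ v = (((H φ).minEnergyOn K : ℝ) : ℂ) • v) →
      ∀ (T : (ι → ℂ) → (ι → ℂ)), (∀ (c : ℂ) (v : ι → ℂ), T (c • v) = star c • T v) →
      (∀ u v : ι → ℂ, T (u + v) = T u + T v) → (∀ v : ι → ℂ, T (T v) = v) →
      (∀ v ∈ K, T v ∈ K) → (∀ (φ : Fin 2 → ℝ) (v : ι → ℂ), T (H φ *ᵥ v) = H φ *ᵥ T v) →
      (∀ u v : ι → ℂ, star (T u) ⬝ᵥ T v = star (star u ⬝ᵥ v)) →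
      ∀ (p : Fin 2 → ℝ) (V : Fin 2 → Matrix ι ι ℂ) (C : ℝ),
      (∀ (μ : Fin 2) (x w : ι → ℂ), star x ⬝ᵥ x = 1 → star w ⬝ᵥ w = 1 →
        ‖star x ⬝ᵥ (V μ *ᵥ w)‖ ≤ C) →
      (∀ ε : ℝ, 0 < ε → ∃ δ : ℝ, 0 < δ ∧ ∀ y : Fin 2 → ℝ,
        Real.sqrt (y 0 ^ 2 + y 1 ^ 2) ≤ δ → ∀ x w : ι → ℂ, star x ⬝ᵥ x = 1 → star w ⬝ᵥ w = 1 →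
          ‖star x ⬝ᵥ ((H (fun ν => p ν + y ν) - H p -
              (((y 0 : ℝ) : ℂ) • V 0 + ((y 1 : ℝ) : ℂ) • V 1)) *ᵥ w)‖ ≤
            ε * Real.sqrt (y 0 ^ 2 + y 1 ^ 2)) →
      (∃ ψ₁ ψ₂ : ι → ℂ,
        (ψ₁ ∈ K ∧ ψ₁ ≠ 0 ∧ H p *ᵥ ψ₁ = (((H p).minEnergyOn K : ℝ) : ℂ) • ψ₁) ∧
        (ψ₂ ∈ K ∧ ψ₂ ≠ 0 ∧ H p *ᵥ ψ₂ = (((H p).minEnergyOn K : ℝ) : ℂ) • ψ₂) ∧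
        star ψ₁ ⬝ᵥ ψ₂ = 0 ∧
        ∀ χ : ι → ℂ, (χ ∈ K ∧ χ ≠ 0 ∧ H p *ᵥ χ = (((H p).minEnergyOn K : ℝ) : ℂ) • χ) →
          ∃ z₁ z₂ : ℂ, χ = z₁ • ψ₁ + z₂ • ψ₂) →
      (∃ m : ℝ, 0 < m ∧ ∃ ρ : ℝ, 0 < ρ ∧ ∀ φ : Fin 2 → ℝ,
        0 < (φ 0 - p 0) ^ 2 + (φ 1 - p 1) ^ 2 → (φ 0 - p 0) ^ 2 + (φ 1 - p 1) ^ 2 ≤ ρ ^ 2 →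
        ∀ ψ χ : ι → ℂ, (ψ ∈ K ∧ ψ ≠ 0 ∧ H φ *ᵥ ψ = (((H φ).minEnergyOn K : ℝ) : ℂ) • ψ) →
          χ ∈ K → star ψ ⬝ᵥ χ = 0 → star χ ⬝ᵥ χ = 1 →
            (H φ).minEnergyOn K + m * Real.sqrt ((φ 0 - p 0) ^ 2 + (φ 1 - p 1) ^ 2) ≤
              (star χ ⬝ᵥ (H φ *ᵥ χ)).re) →
      ∃ r₀ : ℝ, 0 < r₀ ∧ ∀ r : ℝ, 0 < r → r ≤ r₀ →
        ∃ n₀ : ℕ, ∀ n ≥ n₀, ∀ ψ : Fin n → ι → ℂ,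
          (∀ i : Fin n,
            ((ψ i) ∈ K ∧ ψ i ≠ 0 ∧
              H (fun ν : Fin 2 => p ν + r *
                  (if ν = 0 then Real.cos (2 * Real.pi * (i : ℕ) / n)
                    else Real.sin (2 * Real.pi * (i : ℕ) / n))) *ᵥ ψ i =
                (((H (fun ν : Fin 2 => p ν + r *
                  (if ν = 0 then Real.cos (2 * Real.pi * (i : ℕ) / n)
                    else Real.sin (2 * Real.pi * (i : ℕ) / n)))).minEnergyOn K : ℝ) : ℂ) • ψ i) ∧
            star (ψ i) ⬝ᵥ ψ i = 1) →
          (∏ i : Fin n, star (ψ i) ⬝ᵥ ψ (finRotate n i)).re < 0 := by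
  intro ι _ _ K H hHerm hHK hlb hex T hTs hTadd hTT hTK hTH hTd p V C hCV hTaylor h2 hcone
  obtain ⟨m, hm, ρc, hρc, hc⟩ := hcone
  have hpi := Real.pi_pos
  /- Step 1: the `T`-real frame and the gap at `p` (M1), the energy estimates (M2). -/
  obtain ⟨e₁, e₂, he₁K, he₂K, hTe₁, hTe₂, he₁, he₂, he₁₂, hHe₁, hHe₂, g, hg, hgap⟩ :=
    stub_coneFrame K (H p) (hHerm p) (hHK p) ((H p).minEnergyOn K) (hlb p) T hTs hTadd hTT hTK
      (hTH p) hTd h2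
  obtain ⟨hnd, hclose⟩ := hM2 K H p (hHerm p) hlb hex V C hCV hTaylor e₁ e₂ he₁K he₂K he₁ he₂
    he₁₂ hHe₁ hHe₂ g hg hgap
  /- Step 2: the real linear pencil `(a(u), β(u)) = (A 0 u₀ + A 1 u₁, B 0 u₀ + B 1 u₁)`. -/
  have him12 : ∀ μ, (star e₁ ⬝ᵥ (V μ *ᵥ e₂)).im = 0 := fun μ =>
    im_pencil_entry_eq_zero H p V hTH hTd hTaylor hTe₁ hTe₂ he₁ he₂ μ
  have him21 : ∀ μ, (star e₂ ⬝ᵥ (V μ *ᵥ e₁)).im = 0 := fun μ =>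
    im_pencil_entry_eq_zero H p V hTH hTd hTaylor hTe₂ hTe₁ he₂ he₁ μ
  set A : Fin 2 → ℝ := fun μ =>
    ((star e₁ ⬝ᵥ (V μ *ᵥ e₁)).re - (star e₂ ⬝ᵥ (V μ *ᵥ e₂)).re) / 2 with hA
  set B : Fin 2 → ℝ := fun μ =>
    ((star e₁ ⬝ᵥ (V μ *ᵥ e₂)).re + (star e₂ ⬝ᵥ (V μ *ᵥ e₁)).re) / 2 with hB
  have hfa : ∀ u : Fin 2 → ℝ,
      ((star e₁ ⬝ᵥ ((((u 0 : ℝ) : ℂ) • V 0 + ((u 1 : ℝ) : ℂ) • V 1) *ᵥ e₁)).re -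
        (star e₂ ⬝ᵥ ((((u 0 : ℝ) : ℂ) • V 0 + ((u 1 : ℝ) : ℂ) • V 1) *ᵥ e₂)).re) / 2 =
      A 0 * u 0 + A 1 * u 1 := by
    intro u
    rw [pencil_coeff_linear, pencil_coeff_linear]
    simp only [hA, Complex.add_re, Complex.re_ofReal_mul]
    ring
  have hfb : ∀ u : Fin 2 → ℝ,
      (star e₁ ⬝ᵥ ((((u 0 : ℝ) : ℂ) • V 0 + ((u 1 : ℝ) : ℂ) • V 1) *ᵥ e₂) +
        star (star e₂ ⬝ᵥ ((((u 0 : ℝ) : ℂ) • V 0 + ((u 1 : ℝ) : ℂ) • V 1) *ᵥ e₁))) / 2 =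
      (((B 0 * u 0 + B 1 * u 1 : ℝ)) : ℂ) := by
    intro u
    rw [pencil_coeff_linear, pencil_coeff_linear]
    apply Complex.ext
    · simp only [hB, Complex.div_ofNat_re, Complex.add_re, Complex.re_ofReal_mul, Complex.star_def,
        Complex.conj_re, Complex.ofReal_re]
      ring
    · simp only [Complex.div_ofNat_im, Complex.add_im, Complex.im_ofReal_mul, Complex.star_def,
        Complex.conj_im, Complex.ofReal_im, him12, him21]
      ring
  -- nondegeneracy (M2 (i)) and the determinant
  have hnd' : ∀ u : Fin 2 → ℝ, u 0 ^ 2 + u 1 ^ 2 = 1 →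
      (m / 2) ^ 2 ≤ (A 0 * u 0 + A 1 * u 1) ^ 2 + (B 0 * u 0 + B 1 * u 1) ^ 2 := by
    intro u hu
    have h := hnd m ρc hm hρc hc u hu _ _ rfl rfl
    rw [hfa u, hfb u, Complex.norm_real, Real.norm_eq_abs, sq_abs] at h
    exact h
  have hdet : A 0 * B 1 - A 1 * B 0 ≠ 0 := det_ne_zero_of_pencil_nondeg hm hnd'
  /- Step 3: the antiperiodic square root around the ellipse (M3) and the mesh. -/
  obtain ⟨E, hEc, hE1, hEanti, hEsq⟩ := stub_ellipseSqrt (A 0) (A 1) (B 0) (B 1) hdet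
  obtain ⟨n₁, hn₁⟩ := mesh_of_unit_continuous hEc hE1
  /- Step 4: the closeness radius (M2 (ii)) with `η + η/m ≤ 1/64`. -/
  set η : ℝ := min (1 / 128) (m / 128) with hη
  have hη0 : 0 < η := lt_min (by norm_num) (by positivity)
  have hη1 : η ≤ 1 / 128 := min_le_left _ _
  have hηm : η / m ≤ 1 / 128 := by
    rw [div_le_iff₀ hm]
    calc η ≤ m / 128 := min_le_right _ _
      _ = 1 / 128 * m := by ring
  obtain ⟨r₁, hr₁, hcl⟩ := hclose η hη0
  refine ⟨min ρc r₁, lt_min hρc hr₁, fun r hr hrle => ⟨n₁ + 1, fun n hn ψ hψ => ?_⟩⟩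
  have hrρ : r ≤ ρc := hrle.trans (min_le_left _ _)
  have hrr : r ≤ r₁ := hrle.trans (min_le_right _ _)
  have hn1 : 1 ≤ n := by omega
  have hn0 : (0 : ℝ) < n := by exact_mod_cast (by omega : 0 < n)
  /- Step 5: the circle points, uniqueness (cone) and `T`-real unit sections. -/
  set θ : Fin n → ℝ := fun i => 2 * Real.pi * (i : ℕ) / n with hθ
  set u : Fin n → Fin 2 → ℝ := fun i ν => if ν = 0 then Real.cos (θ i) else Real.sin (θ i) with hu
  set pt : Fin n → Fin 2 → ℝ := fun i ν => p ν + r * u i ν with hpt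
  have hψ' : ∀ i, (ψ i ∈ K ∧ ψ i ≠ 0 ∧
      H (pt i) *ᵥ ψ i = (((H (pt i)).minEnergyOn K : ℝ) : ℂ) • ψ i) ∧ star (ψ i) ⬝ᵥ ψ i = 1 :=
    fun i => hψ i
  have hunit : ∀ i, u i 0 ^ 2 + u i 1 ^ 2 = 1 := fun i => circleDir_unit (θ i)
  have hdist : ∀ i, (pt i 0 - p 0) ^ 2 + (pt i 1 - p 1) ^ 2 = r ^ 2 := fun i =>
    circlePoint_dist_sq p r (θ i)
  have huniq : ∀ i, ∀ χ₁ χ₂ : ι → ℂ,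
      (χ₁ ∈ K ∧ χ₁ ≠ 0 ∧ H (pt i) *ᵥ χ₁ = (((H (pt i)).minEnergyOn K : ℝ) : ℂ) • χ₁) →
      (χ₂ ∈ K ∧ χ₂ ≠ 0 ∧ H (pt i) *ᵥ χ₂ = (((H (pt i)).minEnergyOn K : ℝ) : ℂ) • χ₂) →
      ∃ z : ℂ, χ₂ = z • χ₁ := by
    intro i χ₁ χ₂ h₁ h₂'
    refine groundState_unique_of_cone K (H (pt i)) (m' := m * r) (by positivity) ?_ h₁ h₂'
    intro ψ₀ χ hψ₀ hχ h0 h1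
    have h := hc (pt i) (by rw [hdist i]; positivity)
      (by rw [hdist i]; exact pow_le_pow_left₀ hr.le hrρ 2) ψ₀ χ hψ₀ hχ h0 h1
    rwa [hdist i, Real.sqrt_sq hr.le] at h
  have hsec : ∀ i, ∃ s : ι → ℂ, (s ∈ K ∧ s ≠ 0 ∧
      H (pt i) *ᵥ s = (((H (pt i)).minEnergyOn K : ℝ) : ℂ) • s) ∧ star s ⬝ᵥ s = 1 ∧ T s = s :=
    fun i => exists_real_unit_groundState K (H (pt i)) hTs hTK (hTH _) hTd (hex _) (huniq i)
  choose sec hsecGS hsec1 hsecT using hsec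
  /- Step 6: phases cancel; the links are real. -/
  have hz : ∀ i, ∃ z : ℂ, ψ i = z • sec i := fun i => huniq i (sec i) (ψ i) (hsecGS i) (hψ' i).1
  choose z hz using hz
  have hz1 : ∀ i, ‖z i‖ = 1 := fun i => by
    have h := (hψ' i).2
    rw [hz i] at h
    exact norm_eq_one_of_unit_smul (hsec1 i) h
  set ℓ : Fin n → ℝ := fun i => (star (sec i) ⬝ᵥ sec (finRotate n i)).re with hℓ
  have hprod : ∏ i : Fin n, star (ψ i) ⬝ᵥ ψ (finRotate n i) = ((∏ i, ℓ i : ℝ) : ℂ) := by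
    have h1 : ∏ i : Fin n, star (ψ i) ⬝ᵥ ψ (finRotate n i) =
        ∏ i : Fin n, star (z i • sec i) ⬝ᵥ (z (finRotate n i) • sec (finRotate n i)) := by
      refine Finset.prod_congr rfl fun i _ => ?_
      rw [← hz i, ← hz (finRotate n i)]
    rw [h1, prod_star_smul_dotProduct_smul (finRotate n) z hz1 sec, Complex.ofReal_prod]
    refine Finset.prod_congr rfl fun i _ => ?_
    exact star_dotProduct_ofReal_of_real hTd (hsecT i) (hsecT _)
  rw [hprod, Complex.ofReal_re]
  /- Step 7: the ideal vectors `ẽ i = Re E(θ i) e₁ + Im E(θ i) e₂` and the overlaps `t i`. -/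
  set ee : Fin n → ι → ℂ := fun i =>
    (((E (θ i)).re : ℝ) : ℂ) • e₁ + (((E (θ i)).im : ℝ) : ℂ) • e₂ with hee
  set t : Fin n → ℝ := fun i => (star (ee i) ⬝ᵥ sec i).re with ht
  have hee1 : ∀ i, star (ee i) ⬝ᵥ ee i = 1 := by
    intro i
    rw [hee, frame_dot_frame he₁ he₂ he₁₂]
    have h := re_sq_add_im_sq_of_norm_eq_one (hE1 (θ i))
    rw [Complex.star_def, Complex.conj_ofReal, Complex.conj_ofReal,
      ← Complex.ofReal_mul, ← Complex.ofReal_mul, ← Complex.ofReal_add]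
    rw [← pow_two, ← pow_two, h, Complex.ofReal_one]
  have heeT : ∀ i, T (ee i) = ee i := fun i => antiunitary_frame hTs hTadd hTe₁ hTe₂ _ _
  have hte : ∀ i, star (ee i) ⬝ᵥ sec i = ((t i : ℝ) : ℂ) := fun i =>
    star_dotProduct_ofReal_of_real hTd (heeT i) (hsecT i)
  -- `t i ^ 2 ≥ 63/64` from M2 (ii) and the pencil identity
  have htt : ∀ i, 1 - 1 / 64 ≤ t i ^ 2 := by
    intro i
    obtain ⟨hout, hdev⟩ := hcl r hr hrr (u i) (hunit i) _ _ rfl rfl (sec i) (hsecGS i) (hsec1 i)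
    rw [hfa (u i), hfb (u i)] at hdev
    rw [Complex.norm_real, Real.norm_eq_abs, sq_abs] at hdev
    have hu0 : u i 0 = Real.cos (θ i) := by simp [hu]
    have hu1 : u i 1 = Real.sin (θ i) := by simp [hu]
    rw [hu0, hu1] at hdev
    -- the square root data at `θ i`
    have hsq := pencil_re_im_of_sq (hEsq (θ i))
    have hxy := re_sq_add_im_sq_of_norm_eq_one (hE1 (θ i))
    have hρ : m / 2 ≤ Real.sqrt ((A 0 * Real.cos (θ i) + A 1 * Real.sin (θ i)) ^ 2 +
        (B 0 * Real.cos (θ i) + B 1 * Real.sin (θ i)) ^ 2) := by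
      refine (Real.le_sqrt' (by positivity)).2 ?_
      have h := hnd' (u i) (hunit i)
      rwa [hu0, hu1] at h
    have hlow := pencil_lower_bound hxy hsq.1 hsq.2 hm hρ hη0.le hout hdev
    -- `|t i|² = |x c₁ + y c₂|²`
    have hteq : ((t i : ℝ) : ℂ) = (((E (θ i)).re : ℝ) : ℂ) * (star e₁ ⬝ᵥ sec i) +
        (((E (θ i)).im : ℝ) : ℂ) * (star e₂ ⬝ᵥ sec i) := by
      rw [← hte i, hee, frame_dot, Complex.star_def, Complex.conj_ofReal, Complex.conj_ofReal]
    have htn : t i ^ 2 = ‖(((E (θ i)).re : ℝ) : ℂ) * (star e₁ ⬝ᵥ sec i) +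
        (((E (θ i)).im : ℝ) : ℂ) * (star e₂ ⬝ᵥ sec i)‖ ^ 2 := by
      rw [← hteq, Complex.norm_real, Real.norm_eq_abs, sq_abs]
    rw [htn]
    have : η + η / m ≤ 1 / 64 := by linarith
    linarith
  /- Step 8: the ideal links: `Re ⟨ẽ i, ẽ j⟩ = Re (conj E(θ i) · E(θ j))`; mesh and wrap. -/
  have hff : ∀ i j, (star (ee i) ⬝ᵥ ee j).re = (conj (E (θ i)) * E (θ j)).re := by
    intro i j
    rw [hee, frame_dot_frame he₁ he₂ he₁₂]
    simp only [Complex.add_re, Complex.mul_re, Complex.star_def, Complex.conj_re, Complex.conj_im,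
      Complex.ofReal_re, Complex.ofReal_im, mul_zero, sub_zero]
    ring
  have hθmem : ∀ i : Fin n, θ i ∈ Set.Icc (0 : ℝ) 7 := fun i => mesh_angle_mem_Icc i
  have h2πmem : (2 * Real.pi) ∈ Set.Icc (0 : ℝ) 7 := ⟨by positivity, by nlinarith [Real.pi_lt_d2]⟩
  /- Step 9: every corrected link is positive; conclude. -/
  refine prod_neg_of_link_signs hn1 ℓ t fun i => ?_
  obtain ⟨k, rfl⟩ : ∃ k, n = k + 1 := ⟨n - 1, by omega⟩
  by_cases hlast : (i : ℕ) + 1 = k + 1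
  · -- the wrap-around link: `finRotate i = 0`, `E(θ 0) = E 0 = -E(2π)`
    have hil : i = Fin.last k := Fin.ext (by rw [Fin.val_last]; omega)
    have hσ : finRotate (k + 1) i = 0 := by rw [hil, finRotate_last]
    have hL : 1 / 2 ≤ (-1 : ℝ) * (star (ee i) ⬝ᵥ ee (finRotate (k + 1) i)).re := by
      rw [hff, hσ]
      have hθ0 : θ 0 = 0 := by simp [hθ]
      have hE0 : E (θ 0) = -E (2 * Real.pi) := by
        have h := hEanti 0
        rw [zero_add] at h
        rw [hθ0, h, neg_neg]
      rw [hE0, mul_neg, Complex.neg_re]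
      have hθi : θ i = 2 * Real.pi - 2 * Real.pi / (k + 1 : ℕ) := by
        have hik : ((i : ℕ) : ℝ) = k := by exact_mod_cast (show (i : ℕ) = k by omega)
        simp only [hθ, hik]
        field_simp
        push_cast
        ring
      have hd : |θ i - 2 * Real.pi| ≤ 2 * Real.pi / (k + 1 : ℕ) := by
        rw [hθi, show 2 * Real.pi - 2 * Real.pi / (k + 1 : ℕ) - 2 * Real.pi =
          -(2 * Real.pi / (k + 1 : ℕ)) by ring, abs_neg, abs_of_pos (by positivity)]
      have h := hn₁ (k + 1) (by omega) (θ i) (hθmem i) (2 * Real.pi) h2πmem hd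
      linarith
    rw [if_pos hlast]
    exact link_sign (hee1 i) (hee1 _) (hsec1 i) (hsec1 _) (hte i) (hte _) (by norm_num) le_rfl
      (htt i) (htt _) (Or.inr rfl) hL
  · -- a regular link: `finRotate i = i + 1`, `θ (σ i) = θ i + 2π/n`
    have hil : i ≠ Fin.last k := fun h => hlast (by rw [h, Fin.val_last])
    have hσ : ((finRotate (k + 1) i : ℕ) : ℕ) = (i : ℕ) + 1 := coe_finRotate_of_ne_last hil
    have hL : 1 / 2 ≤ (1 : ℝ) * (star (ee i) ⬝ᵥ ee (finRotate (k + 1) i)).re := by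
      rw [hff, one_mul]
      have hθσ : θ (finRotate (k + 1) i) = θ i + 2 * Real.pi / (k + 1 : ℕ) := by
        rw [hθ]
        simp only
        rw [hσ]
        push_cast
        ring
      have hd : |θ i - θ (finRotate (k + 1) i)| ≤ 2 * Real.pi / (k + 1 : ℕ) := by
        rw [hθσ, show θ i - (θ i + 2 * Real.pi / (k + 1 : ℕ)) = -(2 * Real.pi / (k + 1 : ℕ)) by
          ring, abs_neg, abs_of_pos (by positivity)]
      exact hn₁ (k + 1) (by omega) (θ i) (hθmem i) (θ _) (hθmem _) hd
    rw [if_neg hlast]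
    exact link_sign (hee1 i) (hee1 _) (hsec1 i) (hsec1 _) (hte i) (hte _) (by norm_num) le_rfl
      (htt i) (htt _) (Or.inl rfl) hL

end Summit.HubbardSuperconductivity.HubbardSuperconductivity.Theorems.NodalDiracTwist
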